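import Summits.HodgeConjecture.HodgeConjecture.Theorems.EquidimSocketThickLinkedLift
import Summits.HodgeConjecture.HodgeConjecture.Theorems.EquidimThickTransfer
import HarnessLib

/-!
# E-road: NO THIN PIECE of the Siegel moduli scheme, modulo the isogeny-quotient maps (socket (B) of the Hecke link)

Cell hodgecm-mathlib (D-0151), E-road «EQUIDIM by proof» (skeleton `Cruxes/HDel/Lines/EquidimOfF.lean`, residual `stub_noThinPiece`),
Hecke-link line card v1.1 (B-plan1 (g14)); TREE EDITION of the B6 glue of B-p01 (g13)'s probe v6 (`noThinPiece_of_socketQuotientMap`):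
socket (A) «a THICK Hecke-linked upstairs point exists» is ★ `EquidimSocketThickLinkedLift.thickLinkedLift_heckeLinked` (B-p08 (g9),
over ★ H0, ★ B3+, ★ (P1), ★ thick lift, ★ (R4) `SiegelModuliTower.trLiftsRelDim`, ★ (U), ★ (A4)); the transfer (T2) is ★
`EquidimThickTransfer.isThickAt_of_periodCompatible_of_continuous`; THICK ⇒ `g(g+1)/2 ≤ d` is ★ `EquidimThickIffLe.le_of_isThickAt`.
What remains is socket (B), «THE ISOGENY-QUOTIENT MAP» (B4: H1–H4, B-p14 (g14) / B-p20 (g9) / B-p21 (g14)), taken here as the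
HYPOTHESIS `hQuot` in its text of record (probe v6 `SocketQuotientMap HeckeLinked`, v5 shape with the thickness binder).  THEOREMS ONLY,
`--as helper` capital for `stmt-HodgeConjecture-24835` (count-neutral).  HC_CM is proved only modulo the 7 printed citations until rung 0
closes.

* `stubThick_of_quotientMaps (hF) (hQuot) … (t) : IsThickAt hδ 𝓜 ι d t` — every complex point of every smooth open piece of `𝓜_ℂ`
  is THICK;
* `noThinPiece_of_quotientMaps (hF) (hQuot) … (q) (hq) : g(g+1)/2 ≤ d` — the text of the E-road residual `NoThinPiece` (every smooth
  open piece of `𝓜_ℂ` with a `ℂ`-point has relative dimension `≥ g(g+1)/2`), modulo `hQuot` alone.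

## References
* [LangeBirkenhake1992] H. Lange, Ch. Birkenhake, *Complex Abelian Varieties* (1992), Ch. 8 §8.1.
* [MumfordFogartyKirwan1994] GIT 3rd ed., Ch. 7 §3 Thm. 7.9 (p. 139), App. 7A (p. 235).
* [Milne2005ShimuraVarieties] J. S. Milne, *Introduction to Shimura varieties* (2005), §6 Thm. 6.11 (pp. 74–75) (Hecke correspondences).
-/

set_option autoImplicit false
set_option linter.dupNamespace false  -- `Summit.HodgeConjecture.HodgeConjecture.…` is the cell's layout (D-0017)

noncomputable section

open CategoryTheory CategoryTheory.Limits AlgebraicGeometry Matrix Topology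
open Literature.AlgebraicGeometry
open Literature.AlgebraicGeometry.Motives (SchemeOver ComplexPoints AlgPoints specOver)
open Literature.AlgebraicGeometry.AbelianSchemes (PolarizedAbelianSchemeWithLevel)
open Literature.AlgebraicGeometry.ModuliOfAbelianVarieties
open Literature.AlgebraicGeometry.ModuliOfAbelianVarieties.EquidimOfF
open Literature.NumberTheory.Automorphic (siegelUpperHalfSpace)
open Literature.NumberTheory.Adeles

namespace Summit.HodgeConjecture.HodgeConjecture.Theorems

namespace EquidimNoThinPiece

open SiegelModuli

variable {g : ℕ}

/-- **EVERY COMPLEX POINT OF EVERY SMOOTH OPEN PIECE OF `𝓜_ℂ` IS THICK, modulo the isogeny-quotient maps** (socket (B), hypothesis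
`hQuot` = the text of `SocketQuotientMap HeckeLinked`): at `t`, ★ socket (A) gives `(𝓜′, ι′, r′, s′)` upstairs with `s′` thick w.r.t.
`r′` and `ι′ s′` Hecke-linked to `ι t`; `hQuot` gives the period-compatible continuous `Φ` with `Φ s′ = ι t`; ★ (T2) transfers thickness.
[cite: LangeBirkenhake1992, Ch. 8 §8.1] [cite: Milne2005ShimuraVarieties, §6 Thm. 6.11 pp. 74–75] -/
theorem stubThick_of_quotientMaps (hF : lan2013_siegelFineModuliScheme)
    (hQuot : ∀ (_hF : lan2013_siegelFineModuliScheme) (g N N' : ℕ) (δ δ' : Fin g → ℕ) (_hg : 0 < g)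
      (hδ : IsPolarizationType δ) (_hN : 3 ≤ N) (hδ' : IsPolarizationType δ')
      (𝓜 : SiegelFineModuliScheme g N δ) (𝓜' : SiegelFineModuliScheme g N' δ')
      (S'' : SchemeOver ℂ) (ι' : S'' ⟶ (Motives.baseChange ℚ ℂ).obj 𝓜'.M)
      (d'' : ℕ) [SmoothOfRelativeDimension d'' S''.hom] (r' : gspFinAdelic δ') (_ : r' ∈ principalLevelSubgroup δ' 1)
      (s' : ComplexPoints S'') (_ : IsThickAtWith hδ' 𝓜' ι' d'' s' r')
      (x : ComplexPoints ((Motives.baseChange ℚ ℂ).obj 𝓜.M)),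
      HeckeLinked 𝓜 𝓜' r' (AlgPoints.map (L := ℂ) ι' s') x →
      haveI : IsLocallyNoetherian (specOver ℚ ℂ).left := inferInstanceAs (IsLocallyNoetherian (Spec (CommRingCat.of ℂ)))
      ∃ (Φ : ComplexPoints S'' → ComplexPoints ((Motives.baseChange ℚ ℂ).obj 𝓜.M)) (_ : Continuous Φ) (_ : Φ s' = x)
        (θ : siegelUpperHalfSpace g → siegelUpperHalfSpace g) (_ : IsOpenMap θ)
        (r : gspFinAdelic δ) (_ : r ∈ principalLevelSubgroup δ 1),
        ∀ (s : ComplexPoints S'') (Z : siegelUpperHalfSpace g)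
          (P' : PolarizedAbelianSchemeWithLevel g N' δ' (specOver ℚ ℂ).left),
          IsAdmissibleAt hδ' r' Z.1 Z.2 P' →
          AlgPoints.baseChangeEquiv (algebraMap ℚ ℂ) 𝓜'.M (𝓜'.classifyingMap (specOver ℚ ℂ) P') =
            AlgPoints.map (L := ℂ) ι' s →
          ∃ P : PolarizedAbelianSchemeWithLevel g N δ (specOver ℚ ℂ).left,
            IsAdmissibleAt hδ r (θ Z).1 (θ Z).2 P ∧
            AlgPoints.baseChangeEquiv (algebraMap ℚ ℂ) 𝓜.M (𝓜.classifyingMap (specOver ℚ ℂ) P) = Φ s)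
    (N : ℕ) (δ : Fin g → ℕ) (hg : 0 < g) (hδ : IsPolarizationType δ) (hN : 3 ≤ N) (𝓜 : SiegelFineModuliScheme g N δ)
    {S' : SchemeOver ℂ} (ι : S' ⟶ (Motives.baseChange ℚ ℂ).obj 𝓜.M) [IsOpenImmersion ι.left]
    (d : ℕ) [SmoothOfRelativeDimension d S'.hom] (t : ComplexPoints S') : IsThickAt hδ 𝓜 ι d t := by
  obtain ⟨N', δ', hδ', 𝓜', S'', ι', d'', hd'', r', hr', s', hthick, hlink⟩ :=
    EquidimSocketThickLinkedLift.thickLinkedLift_heckeLinked hF g N δ hg hδ hN 𝓜 (AlgPoints.map (L := ℂ) ι t)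
  haveI := hd''
  obtain ⟨Φ, hΦ, hΦs, θ, hθo, r, hr, hcompat⟩ :=
    hQuot hF g N N' δ δ' hg hδ hN hδ' 𝓜 𝓜' S'' ι' d'' r' hr' s' hthick _ hlink
  exact EquidimThickTransfer.isThickAt_of_periodCompatible_of_continuous hF hg hδ hN hδ' 𝓜 𝓜' ι' d'' s' r' hthick Φ hΦ θ hθo
    r hr hcompat ι d t hΦs.symm

/-- **NO THIN PIECE, modulo the isogeny-quotient maps** — the text of the E-road residual `NoThinPiece` (skeleton v1.1/v1.2): every
smooth open piece `ι : S′ ⟶ 𝓜_ℂ` of relative dimension `d` with a `ℂ`-point has `g(g+1)/2 ≤ d` (★ `EquidimThickIffLe.stub_ge'_of_thick`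
over `stubThick_of_quotientMaps`). [cite: LangeBirkenhake1992, Ch. 8 §8.1] [cite: MumfordFogartyKirwan1994, App. 7A (p. 235)] -/
theorem noThinPiece_of_quotientMaps (hF : lan2013_siegelFineModuliScheme)
    (hQuot : ∀ (_hF : lan2013_siegelFineModuliScheme) (g N N' : ℕ) (δ δ' : Fin g → ℕ) (_hg : 0 < g)
      (hδ : IsPolarizationType δ) (_hN : 3 ≤ N) (hδ' : IsPolarizationType δ')
      (𝓜 : SiegelFineModuliScheme g N δ) (𝓜' : SiegelFineModuliScheme g N' δ')
      (S'' : SchemeOver ℂ) (ι' : S'' ⟶ (Motives.baseChange ℚ ℂ).obj 𝓜'.M)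
      (d'' : ℕ) [SmoothOfRelativeDimension d'' S''.hom] (r' : gspFinAdelic δ') (_ : r' ∈ principalLevelSubgroup δ' 1)
      (s' : ComplexPoints S'') (_ : IsThickAtWith hδ' 𝓜' ι' d'' s' r')
      (x : ComplexPoints ((Motives.baseChange ℚ ℂ).obj 𝓜.M)),
      HeckeLinked 𝓜 𝓜' r' (AlgPoints.map (L := ℂ) ι' s') x →
      haveI : IsLocallyNoetherian (specOver ℚ ℂ).left := inferInstanceAs (IsLocallyNoetherian (Spec (CommRingCat.of ℂ)))
      ∃ (Φ : ComplexPoints S'' → ComplexPoints ((Motives.baseChange ℚ ℂ).obj 𝓜.M)) (_ : Continuous Φ) (_ : Φ s' = x)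
        (θ : siegelUpperHalfSpace g → siegelUpperHalfSpace g) (_ : IsOpenMap θ)
        (r : gspFinAdelic δ) (_ : r ∈ principalLevelSubgroup δ 1),
        ∀ (s : ComplexPoints S'') (Z : siegelUpperHalfSpace g)
          (P' : PolarizedAbelianSchemeWithLevel g N' δ' (specOver ℚ ℂ).left),
          IsAdmissibleAt hδ' r' Z.1 Z.2 P' →
          AlgPoints.baseChangeEquiv (algebraMap ℚ ℂ) 𝓜'.M (𝓜'.classifyingMap (specOver ℚ ℂ) P') =
            AlgPoints.map (L := ℂ) ι' s →
          ∃ P : PolarizedAbelianSchemeWithLevel g N δ (specOver ℚ ℂ).left,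
            IsAdmissibleAt hδ r (θ Z).1 (θ Z).2 P ∧
            AlgPoints.baseChangeEquiv (algebraMap ℚ ℂ) 𝓜.M (𝓜.classifyingMap (specOver ℚ ℂ) P) = Φ s)
    (N : ℕ) (δ : Fin g → ℕ) (hg : 0 < g) (hδ : IsPolarizationType δ) (hN : 3 ≤ N) (𝓜 : SiegelFineModuliScheme g N δ)
    (S' : SchemeOver ℂ) (ι : S' ⟶ (Motives.baseChange ℚ ℂ).obj 𝓜.M) [IsOpenImmersion ι.left]
    (d : ℕ) [SmoothOfRelativeDimension d S'.hom]
    (q : Spec (CommRingCat.of ℂ) ⟶ S'.left) (hq : q ≫ S'.hom = 𝟙 _) : g * (g + 1) / 2 ≤ d :=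
  EquidimThickIffLe.stub_ge'_of_thick hδ 𝓜
    (fun _ ι' _ d' _ t ↦ stubThick_of_quotientMaps hF hQuot N δ hg hδ hN 𝓜 ι' d' t) S' ι d q hq

/-! ## ed.2 — SOCKETS v6 (B-plan1 (g14) 2026-08-29T21:50:29Z / 21:52:55Z): socket (B) carries `Odd (N′ / N)` as its LAST hypothesis, socket (A) exports it -/

/-- **(sockets v6) EVERY COMPLEX POINT OF EVERY SMOOTH OPEN PIECE OF `𝓜_ℂ` IS THICK, modulo the isogeny-quotient maps at ODD
relative level** (socket (B) v6 = `hQuot` with `Odd (N′ / N)` as the LAST hypothesis before the `∃` — B-plan1 (g14) 2026-08-29T21:50:29Z/21:52:55Z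
(X-amp): the ample representative of `λ_B` needs `N′/N` odd; socket (A) v6 ★ `EquidimSocketThickLinkedLift.thickLinkedLift_heckeLinked_odd`
exports the parity, `ℓ := 2N+1`): at `t`, ★ socket (A) gives `(𝓜′, ι′, r′, s′)` upstairs with `s′` thick w.r.t.
`r′` and `ι′ s′` Hecke-linked to `ι t`; `hQuot` gives the period-compatible continuous `Φ` with `Φ s′ = ι t`; ★ (T2) transfers thickness.
[cite: LangeBirkenhake1992, Ch. 8 §8.1] [cite: Milne2005ShimuraVarieties, §6 Thm. 6.11 pp. 74–75] -/
theorem stubThick_of_quotientMaps₂ (hF : lan2013_siegelFineModuliScheme)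
    (hQuot : ∀ (_hF : lan2013_siegelFineModuliScheme) (g N N' : ℕ) (δ δ' : Fin g → ℕ) (_hg : 0 < g)
      (hδ : IsPolarizationType δ) (_hN : 3 ≤ N) (hδ' : IsPolarizationType δ')
      (𝓜 : SiegelFineModuliScheme g N δ) (𝓜' : SiegelFineModuliScheme g N' δ')
      (S'' : SchemeOver ℂ) (ι' : S'' ⟶ (Motives.baseChange ℚ ℂ).obj 𝓜'.M)
      (d'' : ℕ) [SmoothOfRelativeDimension d'' S''.hom] (r' : gspFinAdelic δ') (_ : r' ∈ principalLevelSubgroup δ' 1)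
      (s' : ComplexPoints S'') (_ : IsThickAtWith hδ' 𝓜' ι' d'' s' r')
      (x : ComplexPoints ((Motives.baseChange ℚ ℂ).obj 𝓜.M)),
      HeckeLinked 𝓜 𝓜' r' (AlgPoints.map (L := ℂ) ι' s') x → Odd (N' / N) →
      haveI : IsLocallyNoetherian (specOver ℚ ℂ).left := inferInstanceAs (IsLocallyNoetherian (Spec (CommRingCat.of ℂ)))
      ∃ (Φ : ComplexPoints S'' → ComplexPoints ((Motives.baseChange ℚ ℂ).obj 𝓜.M)) (_ : Continuous Φ) (_ : Φ s' = x)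
        (θ : siegelUpperHalfSpace g → siegelUpperHalfSpace g) (_ : IsOpenMap θ)
        (r : gspFinAdelic δ) (_ : r ∈ principalLevelSubgroup δ 1),
        ∀ (s : ComplexPoints S'') (Z : siegelUpperHalfSpace g)
          (P' : PolarizedAbelianSchemeWithLevel g N' δ' (specOver ℚ ℂ).left),
          IsAdmissibleAt hδ' r' Z.1 Z.2 P' →
          AlgPoints.baseChangeEquiv (algebraMap ℚ ℂ) 𝓜'.M (𝓜'.classifyingMap (specOver ℚ ℂ) P') =
            AlgPoints.map (L := ℂ) ι' s →
          ∃ P : PolarizedAbelianSchemeWithLevel g N δ (specOver ℚ ℂ).left,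
            IsAdmissibleAt hδ r (θ Z).1 (θ Z).2 P ∧
            AlgPoints.baseChangeEquiv (algebraMap ℚ ℂ) 𝓜.M (𝓜.classifyingMap (specOver ℚ ℂ) P) = Φ s)
    (N : ℕ) (δ : Fin g → ℕ) (hg : 0 < g) (hδ : IsPolarizationType δ) (hN : 3 ≤ N) (𝓜 : SiegelFineModuliScheme g N δ)
    {S' : SchemeOver ℂ} (ι : S' ⟶ (Motives.baseChange ℚ ℂ).obj 𝓜.M) [IsOpenImmersion ι.left]
    (d : ℕ) [SmoothOfRelativeDimension d S'.hom] (t : ComplexPoints S') : IsThickAt hδ 𝓜 ι d t := by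
  obtain ⟨N', δ', hδ', 𝓜', S'', ι', d'', hd'', r', hr', s', hthick, hlink, hodd⟩ :=
    EquidimSocketThickLinkedLift.thickLinkedLift_heckeLinked_odd hF g N δ hg hδ hN 𝓜 (AlgPoints.map (L := ℂ) ι t)
  haveI := hd''
  obtain ⟨Φ, hΦ, hΦs, θ, hθo, r, hr, hcompat⟩ :=
    hQuot hF g N N' δ δ' hg hδ hN hδ' 𝓜 𝓜' S'' ι' d'' r' hr' s' hthick _ hlink hodd
  exact EquidimThickTransfer.isThickAt_of_periodCompatible_of_continuous hF hg hδ hN hδ' 𝓜 𝓜' ι' d'' s' r' hthick Φ hΦ θ hθo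
    r hr hcompat ι d t hΦs.symm

/-- **(sockets v6) NO THIN PIECE, modulo the isogeny-quotient maps at odd relative level** — the text of `NoThinPiece`: every
smooth open piece `ι : S′ ⟶ 𝓜_ℂ` of relative dimension `d` with a `ℂ`-point has `g(g+1)/2 ≤ d` (★ `EquidimThickIffLe.stub_ge'_of_thick`
over `stubThick_of_quotientMaps`). [cite: LangeBirkenhake1992, Ch. 8 §8.1] [cite: MumfordFogartyKirwan1994, App. 7A (p. 235)] -/
theorem noThinPiece_of_quotientMaps₂ (hF : lan2013_siegelFineModuliScheme)
    (hQuot : ∀ (_hF : lan2013_siegelFineModuliScheme) (g N N' : ℕ) (δ δ' : Fin g → ℕ) (_hg : 0 < g)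
      (hδ : IsPolarizationType δ) (_hN : 3 ≤ N) (hδ' : IsPolarizationType δ')
      (𝓜 : SiegelFineModuliScheme g N δ) (𝓜' : SiegelFineModuliScheme g N' δ')
      (S'' : SchemeOver ℂ) (ι' : S'' ⟶ (Motives.baseChange ℚ ℂ).obj 𝓜'.M)
      (d'' : ℕ) [SmoothOfRelativeDimension d'' S''.hom] (r' : gspFinAdelic δ') (_ : r' ∈ principalLevelSubgroup δ' 1)
      (s' : ComplexPoints S'') (_ : IsThickAtWith hδ' 𝓜' ι' d'' s' r')
      (x : ComplexPoints ((Motives.baseChange ℚ ℂ).obj 𝓜.M)),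
      HeckeLinked 𝓜 𝓜' r' (AlgPoints.map (L := ℂ) ι' s') x → Odd (N' / N) →
      haveI : IsLocallyNoetherian (specOver ℚ ℂ).left := inferInstanceAs (IsLocallyNoetherian (Spec (CommRingCat.of ℂ)))
      ∃ (Φ : ComplexPoints S'' → ComplexPoints ((Motives.baseChange ℚ ℂ).obj 𝓜.M)) (_ : Continuous Φ) (_ : Φ s' = x)
        (θ : siegelUpperHalfSpace g → siegelUpperHalfSpace g) (_ : IsOpenMap θ)
        (r : gspFinAdelic δ) (_ : r ∈ principalLevelSubgroup δ 1),
        ∀ (s : ComplexPoints S'') (Z : siegelUpperHalfSpace g)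
          (P' : PolarizedAbelianSchemeWithLevel g N' δ' (specOver ℚ ℂ).left),
          IsAdmissibleAt hδ' r' Z.1 Z.2 P' →
          AlgPoints.baseChangeEquiv (algebraMap ℚ ℂ) 𝓜'.M (𝓜'.classifyingMap (specOver ℚ ℂ) P') =
            AlgPoints.map (L := ℂ) ι' s →
          ∃ P : PolarizedAbelianSchemeWithLevel g N δ (specOver ℚ ℂ).left,
            IsAdmissibleAt hδ r (θ Z).1 (θ Z).2 P ∧
            AlgPoints.baseChangeEquiv (algebraMap ℚ ℂ) 𝓜.M (𝓜.classifyingMap (specOver ℚ ℂ) P) = Φ s)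
    (N : ℕ) (δ : Fin g → ℕ) (hg : 0 < g) (hδ : IsPolarizationType δ) (hN : 3 ≤ N) (𝓜 : SiegelFineModuliScheme g N δ)
    (S' : SchemeOver ℂ) (ι : S' ⟶ (Motives.baseChange ℚ ℂ).obj 𝓜.M) [IsOpenImmersion ι.left]
    (d : ℕ) [SmoothOfRelativeDimension d S'.hom]
    (q : Spec (CommRingCat.of ℂ) ⟶ S'.left) (hq : q ≫ S'.hom = 𝟙 _) : g * (g + 1) / 2 ≤ d :=
  EquidimThickIffLe.stub_ge'_of_thick hδ 𝓜
    (fun _ ι' _ d' _ t ↦ stubThick_of_quotientMaps₂ hF hQuot N δ hg hδ hN 𝓜 ι' d' t) S' ι d q hq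

end EquidimNoThinPiece

end Summit.HodgeConjecture.HodgeConjecture.Theorems

end
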